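import Summits.BirchSwinnertonDyer.Rank1Residual.Additive.QuadraticBranchEvenControlZero
import Summits.BirchSwinnertonDyer.Rank1Residual.Additive.QuadraticBranchEvenExactControl
import Summits.BirchSwinnertonDyer.Rank1Residual.Additive.QuadraticBranchOddStrictExactControlDischarge
import HarnessLib

/-!
# The EVEN Kato-direction half and the even UNIT certificate, DISCHARGED modulo the two readings:
# `(R1⁺) → (R2⁺) → ord_p #Sel_{p^∞}(W/ℚ) ≤ v_p(L_p⁺(V, η, 0))` and
# `L_p⁺(V, η, 0) ∈ ℤ_p^× ⟹ Sel_{p^∞}(W/ℚ) = 0` (cell `bsd-potss`, seat `bsd-potss-ctrl` g2; file 3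
# of the T-e2-r0 series: files 1–2 = p401824 `QuadraticBranchEvenControlZero`, p401865
# `QuadraticBranchEvenExactControl`)

HONEST FRAMING (cell `bsd-potss`, run/shared/lean/pub/bsd-potss/; FULL-BSD rank ≤ 1 programme,
tranche 1b): THEOREMS ONLY — no definition, no named Literature fact, no Summits-side fact
`def … : Prop`, no `sorry`, axioms standard. CONDITIONAL on the two typed READINGS of file 2,
`EvenBranchPlusCharIdealOfPlusMCAt W p` ((R1⁺): (C1_η) read on the `W`-coordinate plus dual data,
Kobayashi §4 + Thm. 2.2 + prime-to-`p` descent) and `EvenBranchPlusNoFiniteSubmoduleAt W p` ((R2⁺):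
Kitajima–Otsuki Main Thm. 1.3, sign `+`), both DISPLAYED as hypotheses; (C1_η) itself is a hypothesis
INSIDE the discharged statements; nothing is booked; no label / mark / count moves; Gss2 / O5a /
O10-PS stay OPEN; nothing about `BSD(W, p)` of any pair is claimed.

## What

For `W/ℚ` globally minimal, `p` odd, `V` a globally minimal model of `W^{(p*)}` with good reduction at
`p` and `a_p(V) = 0`, its newform `f`, the period ratio `ϖ` of the parity of `η`, ANY `L` with the
interpolation property of `L_p⁺(V, η, X)` (`IsQuadraticBranchPlusLFunction f p ϖ L`):

* `finite_and_padicValNat_card_selmerGroupPInfty_le_of_readings` — **(R1⁺) ∧ (R2⁺) ∧ (C1_η)(V) ∧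
  `L(0) ≠ 0` ⟹ `Sel_{p^∞}(W/ℚ)` is finite and `ord_p #Sel_{p^∞}(W/ℚ) ≤ v_p(L(0))`** — the even twin
  of cc-typer-6's typed inequality `QuadraticBranchOddStrictSelmerBoundOfPlusMCAt` (Kato direction +
  control injectivity), by file 1 (`EvenControlZero.…_le_of_quadraticTwist_signedPrime`) on the plus
  dual datum of `Sel⁺(W/ℚ_∞)` over the cyclotomic `ℤ_p`-extension (tree `CyclotomicZp`,
  `nonempty_strictSignedSelmerDualData`), whose characteristic ideal is `(L)` by (R1⁺) and which has
  no finite submodule by (R2⁺).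
* `selmerGroupPInfty_eq_bot_of_readings_of_isUnit` — **the EVEN UNIT CERTIFICATE: (R1⁺) ∧ (R2⁺) ∧
  (C1_η)(V) ∧ `L(0) ∈ ℤ_p^×` ⟹ `Sel_{p^∞}(W/ℚ) = 0`** (TARGET.md v2 §1.1 "(ii) per-pair EVEN unit
  certificates"; it duplicates Kato's Thm. 14.5(3) unit rows in another currency).
* `finite_selmerGroupPInfty_of_readings_of_analyticRankZero`-type corollary is NOT here (the value side
  `L(0) ≠ 0 ⟸ L(W,1) ≠ 0` is the consumer file).

References: [Kobayashi2003] S. Kobayashi, Invent. Math. 152 (2003), Def. 2.1, Thm. 2.2 (p. 5), §4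
(p. 8), (3.6) (p. 7), Lemma 9.1 (p. 25), Thm. 9.3 (p. 26); [GreenbergLNM1716] §4 Thm. 4.1, Lemma 4.2
(p. 102); [KitajimaOtsuki2018] Main Thm. 1.3 (arXiv:1607.03612 p. 3).
-/

noncomputable section

open scoped Classical MatrixGroups ModularForm

open CongruenceSubgroup Field Function NumberField IsDedekindDomain WeierstrassCurve
open Literature.NumberTheory.EllipticCurves
open Literature.NumberTheory.EllipticCurves.ModularForms
open Literature.NumberTheory.EllipticCurves.Kobayashi2003
open Literature.NumberTheory.EllipticCurves.Rank1Residual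
open Literature.NumberTheory.GaloisRepresentations
open Literature.NumberTheory.EllipticCurves.IwasawaAlgebra
open Literature.NumberTheory.EllipticCurves.IwasawaDual ZpExtension

namespace Summit.BirchSwinnertonDyer.Rank1Residual.Additive

namespace EvenControlZero

variable (W : WeierstrassCurve ℚ) [W.IsElliptic] [W.IsGloballyMinimal] (p : ℕ) [hp : Fact p.Prime]

/-- **The EVEN Kato-direction half, modulo the readings (R1⁺), (R2⁺).** For `W`, `p` odd, the good
`a_p = 0` twin `V` (`C • W.quadraticTwist ((−1)^{p/2} p) = V`) with (C1_η), its newform `f`, the period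
ratio `ϖ`, and ANY `L` with `IsQuadraticBranchPlusLFunction f p ϖ L` and `L(0) ≠ 0`:
**`Sel_{p^∞}(W/ℚ)` is finite and `ord_p #Sel_{p^∞}(W/ℚ) ≤ v_p(L(0))`.** Proof: the cyclotomic
`ℤ_p`-extension with a normalised topological generator `γ` (`χ_p(γ) = 1 + p`; tree `CyclotomicZp`) and a
plus dual datum `D` of `Sel⁺(W/ℚ_∞)` (model `ℚ_[p]`) exist; (R1⁺) gives `X⁺` f.g. torsion with
`char = (L)`, (R2⁺) no finite submodule; file 1. CONDITIONAL on the two displayed readings; (C1_η) is a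
hypothesis inside; nothing booked. [cite: Kobayashi2003, §4 (p. 8), Thm. 9.3 (p. 26), Lemma 9.1 (p. 25)]
[cite: KitajimaOtsuki2018, Main Thm. 1.3 (arXiv:1607.03612 p. 3)] [cite: GreenbergLNM1716, §4 Lemma 4.2 (p. 102)] -/
theorem finite_and_padicValNat_card_selmerGroupPInfty_le_of_readings
    (hR1 : EvenBranchPlusCharIdealOfPlusMCAt W p) (hR2 : EvenBranchPlusNoFiniteSubmoduleAt W p)
    (V : WeierstrassCurve ℚ) [V.IsElliptic] [V.IsGloballyMinimal] (C : VariableChange ℚ)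
    {N : ℕ} [NeZero N] {f : CuspForm (Gamma0 N) 2}
    (hp2 : p ≠ 2) (hCV : C • W.quadraticTwist ((-1) ^ (p / 2) * p) = V)
    (hgood : V.HasGoodReductionAtPrime p) (hap : V.frobeniusTrace p = 0)
    (h1 : QuadraticBranchPlusMainConjectureAt V p) (hf : IsNewformOf V f) {ϖ : ℚ}
    (hϖ : if Even (p / 2) then (ϖ : ℝ) * V.realPeriodRat = plusPeriod f
      else (ϖ : ℝ) * V.imaginaryPeriodRat = minusPeriod f)
    {L : IwasawaAlgebra p} (hL : IsQuadraticBranchPlusLFunction f p ϖ L)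
    (h0 : PowerSeries.constantCoeff L ≠ 0) :
    Finite ↥(W.selmerGroupPInfty p) ∧
      (padicValNat p (Nat.card ↥(W.selmerGroupPInfty p)) : ℤ) ≤
        ((PowerSeries.constantCoeff L : ℤ_[p]) : ℚ_[p]).valuation := by
  -- the cyclotomic `ℤ_p`-extension of `ℚ` and a normalised topological generator `γ`
  obtain ⟨γ, hγ, hχ⟩ := CyclotomicZp.exists_isTopGenerator_zpExtension p
  have hκ := CyclotomicZp.isCyclotomic_zpExtension p
  have hγc : IsCyclotomicVariable p γ := ⟨1, IsOfFinOrder.one, by rw [mul_one]; exact hχ⟩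
  -- a plus dual datum of `Sel⁺(W/ℚ_∞)` at the model `ℚ_[p]`
  obtain ⟨D⟩ := nonempty_strictSignedSelmerDualData W (CyclotomicZp.zpExtension p) ℚ_[p] 1 hγ
  -- (R1⁺): `X⁺` f.g. torsion with `char = (L)`; (R2⁺): no finite submodule
  obtain ⟨hfg, htor, hchar⟩ := hR1 V C hp2 hCV hgood hap h1 hf ϖ hϖ L hL _ γ hκ hγ hγc D
  haveI := hfg
  have hnf := hR2 V C hp2 hCV hgood hap _ γ hκ hγ D hfg htor
  exact finite_and_padicValNat_card_selmerGroupPInfty_le_of_quadraticTwist_signedPrime W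
    (CyclotomicZp.zpExtension p) hp2 C V hCV hgood hap hγ D htor hnf hchar h0

/-- **The EVEN UNIT CERTIFICATE, modulo the readings (R1⁺), (R2⁺):** with the data of
`finite_and_padicValNat_card_selmerGroupPInfty_le_of_readings` and `L(0) = L_p⁺(V, η, 0) ∈ ℤ_p^×`,
**`Sel_{p^∞}(W/ℚ) = 0`** (so `W(ℚ) ⊗ ℚ_p/ℤ_p = 0` and `Ш(W)[p^∞] = 0`). CONDITIONAL on the two readings
and (C1_η); nothing booked. [cite: Kobayashi2003, §4 (p. 8), Thm. 9.3 (p. 26), (3.6) (p. 7)]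
[cite: KitajimaOtsuki2018, Main Thm. 1.3 (arXiv:1607.03612 p. 3)] [cite: GreenbergLNM1716, §4 Thm. 4.1] -/
theorem selmerGroupPInfty_eq_bot_of_readings_of_isUnit
    (hR1 : EvenBranchPlusCharIdealOfPlusMCAt W p) (hR2 : EvenBranchPlusNoFiniteSubmoduleAt W p)
    (V : WeierstrassCurve ℚ) [V.IsElliptic] [V.IsGloballyMinimal] (C : VariableChange ℚ)
    {N : ℕ} [NeZero N] {f : CuspForm (Gamma0 N) 2}
    (hp2 : p ≠ 2) (hCV : C • W.quadraticTwist ((-1) ^ (p / 2) * p) = V)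
    (hgood : V.HasGoodReductionAtPrime p) (hap : V.frobeniusTrace p = 0)
    (h1 : QuadraticBranchPlusMainConjectureAt V p) (hf : IsNewformOf V f) {ϖ : ℚ}
    (hϖ : if Even (p / 2) then (ϖ : ℝ) * V.realPeriodRat = plusPeriod f
      else (ϖ : ℝ) * V.imaginaryPeriodRat = minusPeriod f)
    {L : IwasawaAlgebra p} (hL : IsQuadraticBranchPlusLFunction f p ϖ L)
    (hu : IsUnit (PowerSeries.constantCoeff L)) :
    W.selmerGroupPInfty p = ⊥ := by
  obtain ⟨γ, hγ, hχ⟩ := CyclotomicZp.exists_isTopGenerator_zpExtension p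
  have hκ := CyclotomicZp.isCyclotomic_zpExtension p
  have hγc : IsCyclotomicVariable p γ := ⟨1, IsOfFinOrder.one, by rw [mul_one]; exact hχ⟩
  obtain ⟨D⟩ := nonempty_strictSignedSelmerDualData W (CyclotomicZp.zpExtension p) ℚ_[p] 1 hγ
  obtain ⟨hfg, htor, hchar⟩ := hR1 V C hp2 hCV hgood hap h1 hf ϖ hϖ L hL _ γ hκ hγ hγc D
  haveI := hfg
  have hnf := hR2 V C hp2 hCV hgood hap _ γ hκ hγ D hfg htor
  exact selmerGroupPInfty_eq_bot_of_isUnit_of_quadraticTwist_signedPrime W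
    (CyclotomicZp.zpExtension p) hp2 C V hCV hgood hap hγ D htor hnf hchar hu

end EvenControlZero

end Summit.BirchSwinnertonDyer.Rank1Residual.Additive

end
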